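import Mathlib
import Summits.Ventures.PercRepro2.CoinKSureAD

/-!
# The entry-state means of the gate (blind cell PercRepro2, night-2 g14; NIGHT2-DARC.md §49)

`sum_fiber_mean`: on any union of entry states, the gate integrates the state mean of a marker
exactly as it integrates the marker; `sum_mean_eq` its global form; `sum_fiber_prod_le`: the
gate integral of the product of the two state means is at most the gate integral of the product
marker (within-state FKG, `fiber_cov`).
-/

namespace Summit.Ventures.PercRepro2.Coin

open Classical

section GateAbstract

variable {V : Type*} [DecidableEq V] {R : Type*} [Field R] [LinearOrder R] [IsStrictOrderedRing R]

/-- **On a union of states, the state means integrate like the marker itself.** -/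
theorem sum_fiber_mean (U ent : Finset V) (G' x : Finset V → R)
    (hG' : ∀ W, 0 ≤ G' W) (Q : Finset V → Prop) [DecidablePred Q] :
    (∑ W ∈ U.powerset.filter (fun W => Q (W ∩ ent)), G' W *
        ((∑ W' ∈ U.powerset.filter (fun W' => W' ∩ ent = W ∩ ent), G' W' * x W') /
          (∑ W' ∈ U.powerset.filter (fun W' => W' ∩ ent = W ∩ ent), G' W'))) =
      ∑ W ∈ U.powerset.filter (fun W => Q (W ∩ ent)), G' W * x W := by
  have hmaps : ∀ W ∈ U.powerset, (fun W => W ∩ ent) W ∈ ent.powerset :=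
    fun W _ => Finset.mem_powerset.mpr Finset.inter_subset_right
  rw [Finset.sum_filter, Finset.sum_filter,
    ← Finset.sum_fiberwise_of_maps_to hmaps, ← Finset.sum_fiberwise_of_maps_to hmaps]
  refine Finset.sum_congr rfl fun e _ => ?_
  have hL : ∀ W ∈ U.powerset.filter (fun W => (fun W => W ∩ ent) W = e),
      (if Q (W ∩ ent) then G' W *
        ((∑ W' ∈ U.powerset.filter (fun W' => W' ∩ ent = W ∩ ent), G' W' * x W') /
          (∑ W' ∈ U.powerset.filter (fun W' => W' ∩ ent = W ∩ ent), G' W')) else 0) =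
      (if Q e then G' W *
        ((∑ W' ∈ U.powerset.filter (fun W' => W' ∩ ent = e), G' W' * x W') /
          (∑ W' ∈ U.powerset.filter (fun W' => W' ∩ ent = e), G' W')) else 0) := by
    intro W hW
    have h := (Finset.mem_filter.mp hW).2
    simp only at h
    rw [h]
  have hR : ∀ W ∈ U.powerset.filter (fun W => (fun W => W ∩ ent) W = e),
      (if Q (W ∩ ent) then G' W * x W else 0) = (if Q e then G' W * x W else 0) := by
    intro W hW
    have h := (Finset.mem_filter.mp hW).2
    simp only at h
    rw [h]
  rw [Finset.sum_congr rfl hL, Finset.sum_congr rfl hR]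
  by_cases hQ : Q e
  · simp only [if_pos hQ]
    rw [← Finset.sum_mul]
    by_cases hN : (∑ W ∈ U.powerset.filter (fun W => (fun W => W ∩ ent) W = e), G' W) = 0
    · have hz : ∀ W ∈ U.powerset.filter (fun W => (fun W => W ∩ ent) W = e), G' W = 0 :=
        (Finset.sum_eq_zero_iff_of_nonneg (fun W _ => hG' W)).mp hN
      rw [hN, zero_mul]
      symm
      exact Finset.sum_eq_zero (fun W hW => by rw [hz W hW, zero_mul])
    · have hN' : (∑ W' ∈ U.powerset.filter (fun W' => W' ∩ ent = e), G' W') ≠ 0 := hN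
      rw [mul_comm, div_mul_cancel₀ _ hN']
  · simp only [if_neg hQ, Finset.sum_const_zero]

/-- The state means integrate like the markers over the whole lattice. -/
theorem sum_mean_eq (U ent : Finset V) (G' x : Finset V → R) (hG' : ∀ W, 0 ≤ G' W) :
    (∑ W ∈ U.powerset, G' W *
        ((∑ W' ∈ U.powerset.filter (fun W' => W' ∩ ent = W ∩ ent), G' W' * x W') /
          (∑ W' ∈ U.powerset.filter (fun W' => W' ∩ ent = W ∩ ent), G' W'))) =
      ∑ W ∈ U.powerset, G' W * x W := by
  have := sum_fiber_mean U ent G' x hG' (fun _ => True)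
  simpa only [Finset.filter_true] using this

/-- **Within-state FKG, summed**: the product of the state means is dominated by the product
marker. -/
theorem sum_fiber_prod_le (U ent : Finset V) (G' x y : Finset V → R)
    (hG' : ∀ W, 0 ≤ G' W) (hx0 : ∀ W, 0 ≤ x W) (hy0 : ∀ W, 0 ≤ y W)
    (hxm : ∀ s t, x s ≤ x (s ∪ t)) (hym : ∀ s t, y s ≤ y (s ∪ t))
    (wMM : ∀ s ⊆ U, ∀ t ⊆ U, G' s * G' t ≤ G' (s ∩ t) * G' (s ∪ t)) :
    (∑ W ∈ U.powerset, G' W *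
        (((∑ W' ∈ U.powerset.filter (fun W' => W' ∩ ent = W ∩ ent), G' W' * x W') /
          (∑ W' ∈ U.powerset.filter (fun W' => W' ∩ ent = W ∩ ent), G' W')) *
         ((∑ W' ∈ U.powerset.filter (fun W' => W' ∩ ent = W ∩ ent), G' W' * y W') /
          (∑ W' ∈ U.powerset.filter (fun W' => W' ∩ ent = W ∩ ent), G' W')))) ≤
      ∑ W ∈ U.powerset, G' W * (x W * y W) := by
  have hmaps : ∀ W ∈ U.powerset, (fun W => W ∩ ent) W ∈ ent.powerset :=
    fun W _ => Finset.mem_powerset.mpr Finset.inter_subset_right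
  rw [← Finset.sum_fiberwise_of_maps_to hmaps, ← Finset.sum_fiberwise_of_maps_to hmaps]
  refine Finset.sum_le_sum fun e _ => ?_
  have hL : ∀ W ∈ U.powerset.filter (fun W => (fun W => W ∩ ent) W = e),
      G' W * (((∑ W' ∈ U.powerset.filter (fun W' => W' ∩ ent = W ∩ ent), G' W' * x W') /
          (∑ W' ∈ U.powerset.filter (fun W' => W' ∩ ent = W ∩ ent), G' W')) *
         ((∑ W' ∈ U.powerset.filter (fun W' => W' ∩ ent = W ∩ ent), G' W' * y W') /
          (∑ W' ∈ U.powerset.filter (fun W' => W' ∩ ent = W ∩ ent), G' W'))) =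
      G' W * (((∑ W' ∈ U.powerset.filter (fun W' => W' ∩ ent = e), G' W' * x W') /
          (∑ W' ∈ U.powerset.filter (fun W' => W' ∩ ent = e), G' W')) *
         ((∑ W' ∈ U.powerset.filter (fun W' => W' ∩ ent = e), G' W' * y W') /
          (∑ W' ∈ U.powerset.filter (fun W' => W' ∩ ent = e), G' W'))) := by
    intro W hW
    have h := (Finset.mem_filter.mp hW).2
    simp only at h
    rw [h]
  rw [Finset.sum_congr rfl hL, ← Finset.sum_mul]
  have hfib : U.powerset.filter (fun W => (fun W => W ∩ ent) W = e) =
      U.powerset.filter (fun W => W ∩ ent = e) := rfl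
  rw [hfib]
  have hN0 : 0 ≤ ∑ W' ∈ U.powerset.filter (fun W' => W' ∩ ent = e), G' W' :=
    Finset.sum_nonneg fun W _ => hG' W
  have hXY0 : 0 ≤ ∑ W' ∈ U.powerset.filter (fun W' => W' ∩ ent = e), G' W' * (x W' * y W') :=
    Finset.sum_nonneg fun W _ => mul_nonneg (hG' W) (mul_nonneg (hx0 W) (hy0 W))
  rcases hN0.lt_or_eq with hpos | hzero
  · have key := fiber_cov U ent e G' x y hG' hx0 hy0 hxm hym wMM
    rw [div_mul_div_comm, mul_div_assoc', div_le_iff₀ (mul_pos hpos hpos)]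
    calc (∑ W' ∈ U.powerset.filter (fun W' => W' ∩ ent = e), G' W') *
          ((∑ W' ∈ U.powerset.filter (fun W' => W' ∩ ent = e), G' W' * x W') *
            (∑ W' ∈ U.powerset.filter (fun W' => W' ∩ ent = e), G' W' * y W'))
        ≤ (∑ W' ∈ U.powerset.filter (fun W' => W' ∩ ent = e), G' W') *
          ((∑ W' ∈ U.powerset.filter (fun W' => W' ∩ ent = e), G' W') *
            (∑ W' ∈ U.powerset.filter (fun W' => W' ∩ ent = e), G' W' * (x W' * y W'))) :=
          mul_le_mul_of_nonneg_left key hN0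
      _ = _ := by ring
  · rw [← hzero, zero_mul]
    exact hXY0


end GateAbstract

end Summit.Ventures.PercRepro2.Coin
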